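import Summits.BirchSwinnertonDyer.BirchSwinnertonDyer.Theorems.SignedLowerHalvesSmallImageLowerHalfBothSignsRttCharRoadE1KRigidityBaseChange
import Literature.NumberTheory.EllipticCurves.SelmerCorankAssembly
import HarnessLib

/-!
# Route `SignedLowerHalves`, crux L `SmallImageLowerHalfBothSigns` (stmt-BirchSwinnertonDyer-23599), line `rtt_w3` v12 — glue brick T-2 (global half),
# RESTRICTING THE SCALARS TO THE `p`-TORSION: honda's formal-module scalars `u : 𝒪[K_v] → (W_K[p^∞] →+ W_K[p^∞])` (`…RttCharRoadTorsionModule.exists_torsionModule`,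
# p768859) restrict to a unital ring action `u' : 𝒪[K_v] → (W_K[p] →+ W_K[p])` on `geomTorsion (W.baseChange K) p`, keeping the laws, the Galois commutation,
# «`Γ_{K_v}` acts through the scalars» and a non-scalar witness — the inputs `uL`, `hcomm`, `hr₀`, `hτ₀`, `hτ₀s` of `…RttCharRoadE1KRigidityBaseChange.
# exists_torsionAction_eq_transport` (p768789) in exactly its shapes (transported frame `(torsionBaseChangeEquiv K W p).symm.trans e₀`).

Width seat `bsd-line-slh-p3-w3` g18 under LEAD `cruxlead-stmt-BirchSwinnertonDyer-23599` (cell `bsd-ssimc`; `--supports stmt-BirchSwinnertonDyer-23599 --as helper`).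
THEOREMS ONLY (no definition, no named fact, no instance, no `sorry`; the restricted action is produced by `∃`). BSD / crux L / INJ_top are NOT proved here.

* ★ `exists_torsionRestrict` — restriction of a family of additive endomorphisms of `E[p^∞]` to `E[p]`, with transfer of: pointwise ring-action laws, commutation
  with any `σ`, «`σ` acts as `u (χ σ)`», and a non-scalar witness (`u b x ≠ n • x` with `p • x = 0`).
* `coords_ne_smul_of_ne_nsmul`, `coords_ne_smul_one_of_forall_exists_ne_nsmul` — the frame forms `hr₀` / `hτ₀s` of a non-scalar witness.

References: [SilvermanAEC2009] III.7; [Serre1972] §2.2; [SerreGaloisCohomology1997] II §1.1.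
-/

set_option autoImplicit false
set_option linter.dupNamespace false -- D-0017: single-problem summit, the namespace repeats the problem name by design
noncomputable section

open scoped Classical MatrixGroups

universe u

namespace Summit.BirchSwinnertonDyer.BirchSwinnertonDyer.Theorems.SmallImageCharSignedSelmer

open Literature.NumberTheory.GaloisRepresentations Literature.NumberTheory.GaloisRepresentations.Serre1972
  Literature.NumberTheory.EllipticCurves WeierstrassCurve Matrix

/-! ## §1 Restriction `E[p^∞] ⇝ E[p]` of a family of additive endomorphisms -/

section Restrict

variable {L : Type u} [Field L] (E : WeierstrassCurve L) (p : ℕ)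

/-- ★ **Restriction to the `p`-torsion.** A family `u : R → End(E[p^∞])` of additive endomorphisms restricts to `u' : R → End(E[p])` (additive maps preserve
`E[p] = {x | p • x = 0}`), compatibly with the inclusion `E[p] ↪ E[p^∞]`; pointwise ring-action laws, commutation with a Galois element, «`σ` acts as `u (χ σ)`»
and a non-scalar `p`-torsion witness all transfer. [cite: SilvermanAEC2009, III.7] -/
theorem exists_torsionRestrict {R : Type*} [Semiring R] (u : R → (E.geomPrimaryTorsion p →+ E.geomPrimaryTorsion p)) :
    ∃ u' : R → (geomTorsion E p →+ geomTorsion E p),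
      (∀ (b : R) (Q : geomTorsion E p),
        AddSubgroup.inclusion (geomTorsion_le_geomPrimaryTorsion E p) (u' b Q) = u b (AddSubgroup.inclusion (geomTorsion_le_geomPrimaryTorsion E p) Q)) ∧
      ((∀ (a b : R) (x : E.geomPrimaryTorsion p), u (a + b) x = u a x + u b x) →
        ∀ (a b : R) (Q : geomTorsion E p), u' (a + b) Q = u' a Q + u' b Q) ∧
      ((∀ (a b : R) (x : E.geomPrimaryTorsion p), u (a * b) x = u a (u b x)) →
        ∀ (a b : R) (Q : geomTorsion E p), u' (a * b) Q = u' a (u' b Q)) ∧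
      ((∀ x : E.geomPrimaryTorsion p, u 1 x = x) → ∀ Q : geomTorsion E p, u' 1 Q = Q) ∧
      (∀ (σ : Field.absoluteGaloisGroup L) (b : R), (∀ x : E.geomPrimaryTorsion p, u b (σ • x) = σ • u b x) →
        ∀ Q : geomTorsion E p, u' b (σ • Q) = σ • u' b Q) ∧
      (∀ (σ : Field.absoluteGaloisGroup L) (b : R), (∀ x : E.geomPrimaryTorsion p, σ • x = u b x) →
        ∀ Q : geomTorsion E p, σ • Q = u' b Q) ∧
      (∀ (b : R) (n : ℕ), (∃ x : E.geomPrimaryTorsion p, p • x = 0 ∧ u b x ≠ n • x) → ∃ Q : geomTorsion E p, u' b Q ≠ n • Q) := by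
  -- abbreviation for the inclusion
  set incl := AddSubgroup.inclusion (geomTorsion_le_geomPrimaryTorsion E p) with hincl
  have hincl_inj : Function.Injective incl := AddSubgroup.inclusion_injective _
  have hincl_smul : ∀ (σ : Field.absoluteGaloisGroup L) (Q : geomTorsion E p), incl (σ • Q) = σ • incl Q := fun σ Q ↦ Subtype.ext rfl
  -- `u b` preserves the `p`-torsion
  have hmem : ∀ (b : R) (Q : geomTorsion E p), ((u b (incl Q) : E.geomPrimaryTorsion p) : E.geomPoints) ∈ geomTorsion E p := by
    intro b Q
    have hQ : (p : ℤ) • incl Q = 0 := by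
      apply Subtype.ext
      change (p : ℤ) • ((Q : geomTorsion E p) : E.geomPoints) = 0
      exact (mem_geomTorsion_iff E p _).1 Q.2
    rw [mem_geomTorsion_iff]
    change (((p : ℤ) • u b (incl Q) : E.geomPrimaryTorsion p) : E.geomPoints) = 0
    rw [← map_zsmul, hQ, map_zero]
    rfl
  let u' : R → (geomTorsion E p →+ geomTorsion E p) := fun b ↦
    { toFun := fun Q ↦ ⟨((u b (incl Q) : E.geomPrimaryTorsion p) : E.geomPoints), hmem b Q⟩
      map_zero' := Subtype.ext (by
        change (((u b (incl 0)) : E.geomPrimaryTorsion p) : E.geomPoints) = 0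
        rw [map_zero, map_zero]; rfl)
      map_add' := fun Q Q' ↦ Subtype.ext (by
        change (((u b (incl (Q + Q'))) : E.geomPrimaryTorsion p) : E.geomPoints) = _
        rw [map_add, map_add]; rfl) }
  have hu' : ∀ (b : R) (Q : geomTorsion E p), incl (u' b Q) = u b (incl Q) := fun b Q ↦ Subtype.ext rfl
  refine ⟨u', hu', fun hadd a b Q ↦ hincl_inj ?_, fun hmul a b Q ↦ hincl_inj ?_, fun hone Q ↦ hincl_inj ?_,
    fun σ b hσ Q ↦ hincl_inj ?_, fun σ b hσ Q ↦ hincl_inj ?_, fun b n ⟨x, hpx, hx⟩ ↦ ?_⟩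
  · rw [map_add, hu', hu', hu', hadd]
  · rw [hu', hu', hu', hmul]
  · rw [hu', hone]
  · rw [hu', hincl_smul, hincl_smul, hu', hσ]
  · rw [hincl_smul, hu', hσ]
  · -- the witness `x` is `p`-torsion, hence the image of some `Q ∈ E[p]`
    have hxmem : (x : E.geomPoints) ∈ geomTorsion E p := by
      rw [mem_geomTorsion_iff, natCast_zsmul]
      change (((p : ℕ) • x : E.geomPrimaryTorsion p) : E.geomPoints) = 0
      rw [hpx]; rfl
    refine ⟨⟨(x : E.geomPoints), hxmem⟩, fun h ↦ hx ?_⟩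
    have hxQ : incl ⟨(x : E.geomPoints), hxmem⟩ = x := Subtype.ext rfl
    rw [← hxQ, ← hu', h, map_nsmul]

end Restrict

/-! ## §2 Frame forms of a non-scalar witness -/

section Frame

variable {p : ℕ} [Fact p.Prime] {V : Type*} [AddCommGroup V] (e : V ≃+ (Fin 2 → ZMod p))

/-- `hr₀` form: an endomorphism that is not `n •` for any `n` is non-scalar in coordinates. [folklore] -/
theorem coords_ne_smul_of_ne_nsmul (f : V →+ V) (hf : ∀ n : ℕ, ∃ Q : V, f Q ≠ n • Q) (c : ZMod p) :
    ∃ Q : V, e (f Q) ≠ c • e Q := by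
  obtain ⟨Q, hQ⟩ := hf c.val
  refine ⟨Q, fun h ↦ hQ (e.injective ?_)⟩
  rw [h, map_nsmul, ← Nat.cast_smul_eq_nsmul (ZMod p), ZMod.natCast_zmod_val]

/-- `hτ₀s` form: if `e (φ Q) = g *ᵥ e Q` for a map `φ` that is not `n •` for any `n`, then `g` is not a scalar matrix. [folklore] -/
theorem coords_ne_smul_one_of_forall_exists_ne_nsmul (φ : V → V) {g : Matrix (Fin 2) (Fin 2) (ZMod p)} (hφ : ∀ Q : V, e (φ Q) = g *ᵥ e Q)
    (hf : ∀ n : ℕ, ∃ Q : V, φ Q ≠ n • Q) (c : ZMod p) : g ≠ c • 1 := by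
  intro hg
  obtain ⟨Q, hQ⟩ := hf c.val
  apply hQ
  apply e.injective
  rw [hφ, hg, Matrix.smul_mulVec, Matrix.one_mulVec, map_nsmul, ← Nat.cast_smul_eq_nsmul (ZMod p), ZMod.natCast_zmod_val]

end Frame

end Summit.BirchSwinnertonDyer.BirchSwinnertonDyer.Theorems.SmallImageCharSignedSelmer

end
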